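import Summits.KontsevichZagierPeriods.KontsevichZagierPeriods.Theorems.RootDecompRationalCubeDichotomyRankDescentP11

/-! # `RootDecompRationalCubeDichotomyRankDescentP12` — part 12/14 of the mechanical ≤400-line split of `RankDescent_v12_landing.lean` (sha256 00885b8b9882f02e…)
Source: decomp-kz lens-2 g13 `RankDescent_v12.lean` (HOME/decomp-kz-lens-2/g13/, sha256 00885b8b…; critic g5-18…g5-66 CLEARED as NODE v1–v12 for crux stmt-KontsevichZagierPeriods-26322 RationalCubePiKernelSingle: rank dichotomy single_of_fullRankGeTwo + RankLeOneKernel, de Rham-exact descent, linear-in-one-variable / hyperbola / Fermat–hyperbolic / conic classes, transport kit, Brieskorn module; writer g7 l.1222: «landing split §0–4 ∣ … ∣ §16 --supports 26322 endorsed»); `#print axioms` pins removed; landed by census-1 g9.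
Split by census-1 g9 `gen/splitlean.py`: scopes re-opened with their `open`/`variable`/`set_option` context; mathematics and declaration order unchanged. -/

noncomputable section
open MeasureTheory Set MvPolynomial
open Literature.NumberTheory.Transcendental
open Literature.NumberTheory.Transcendental.KZ
namespace Summit.KontsevichZagierPeriods.RootDecompRationalCubeDichotomy.Rung26322.RankDescent
variable {M : ℕ}

/-- **THE CODIMENSION-ONE THEOREM (degree ≤ 2).** For every `Q = ζ + δx + εy + αx² + βxy + γy² ∈ ℚ[x,y]` there is an explicit `ℚ`-linear functional
`Λ_Q` with `P − Λ_Q(P)·1` de Rham-exact over `Q` for EVERY numerator `P` (constructive certificates throughout §6–§13). [folklore] -/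
theorem codimOne_degTwo (α β γ δ ε ζ : ℚ) : CodimOne (conicQ α β γ δ ε ζ) := by
  by_cases hα : α = 0
  swap
  · exact codimOne_degTwo_of_ne_zero α β γ δ ε ζ hα
  subst hα
  by_cases hγ : γ = 0
  swap
  · -- mirror: swap x ↔ y
    have hQ : conicQ 0 β γ δ ε ζ = aeval (affMap 0 1 0 1 0 0) (conicQ γ β 0 ε δ ζ) := by
      simp only [conicQ, affMap, map_add, map_mul, map_pow, aeval_X, MvPolynomial.aeval_C, MvPolynomial.algebraMap_eq,
        Matrix.cons_val_zero, Matrix.cons_val_one, map_one, map_zero, one_mul, zero_mul, add_zero, zero_add]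
      ring
    rw [hQ]
    exact codimOne_affine 0 1 0 1 0 0 (by norm_num) (codimOne_degTwo_of_ne_zero γ β 0 ε δ ζ hγ)
  subst hγ
  by_cases hβ : β = 0
  swap
  · -- `β xy + δ x + ε y + ζ = β (a₀ + (x + ε/β)(y + δ/β))`
    set a₀ := ζ / β - δ * ε / β ^ 2 with ha₀
    have w1 : β * (a₀ + ε / β * (δ / β)) = ζ := by rw [ha₀]; field_simp; ring
    have w2 : β * (ε / β) = ε := by field_simp
    have w3 : β * (δ / β) = δ := by field_simp
    have w1' : (C β * (C a₀ + C (ε / β) * C (δ / β)) : MvPolynomial (Fin 2) ℚ) = C ζ := by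
      rw [← map_mul, ← map_add, ← map_mul, w1]
    have w2' : (C β * C (ε / β) : MvPolynomial (Fin 2) ℚ) = C ε := by rw [← map_mul, w2]
    have w3' : (C β * C (δ / β) : MvPolynomial (Fin 2) ℚ) = C δ := by rw [← map_mul, w3]
    have hQ : conicQ 0 β 0 δ ε ζ = C β * aeval (affMap 1 0 (ε / β) 0 1 (δ / β)) (hypQ a₀) := by
      simp only [conicQ, hypQ, affMap, map_add, map_mul, aeval_X, MvPolynomial.aeval_C, MvPolynomial.algebraMap_eq,
        Matrix.cons_val_zero, Matrix.cons_val_one, map_one, map_zero, one_mul, zero_mul, add_zero, zero_add]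
      linear_combination (-1 : MvPolynomial (Fin 2) ℚ) * w1' - X 0 * w3' - X 1 * w2'
    rw [hQ]
    exact codimOne_C_mul β (codimOne_affine 1 0 (ε / β) 0 1 (δ / β) (by norm_num) (codimOne_hyp a₀))
  subst hβ
  by_cases hδ : δ = 0
  swap
  · -- affine, `δ ≠ 0`: `δ·(x + (ε y + ζ)/δ)`
    have v1 : δ * (ε / δ) = ε := by field_simp
    have v2 : δ * (ζ / δ) = ζ := by field_simp
    have v1' : (C δ * C (ε / δ) : MvPolynomial (Fin 2) ℚ) = C ε := by rw [← map_mul, v1]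
    have v2' : (C δ * C (ζ / δ) : MvPolynomial (Fin 2) ℚ) = C ζ := by rw [← map_mul, v2]
    have hQ : conicQ 0 0 0 δ ε ζ
        = C δ * (X 0 + rename Fin.succ (C (ε / δ) * X 0 + C (ζ / δ) : MvPolynomial (Fin 1) ℚ)) := by
      simp only [conicQ, map_add, map_mul, rename_X, rename_C, Fin.succ_zero_eq_one, map_zero, zero_mul, add_zero]
      linear_combination (-1 : MvPolynomial (Fin 2) ℚ) * v2' - X 1 * v1'
    rw [hQ]
    exact codimOne_C_mul δ (codimOne_monicLinear _)
  · subst hδ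
    refine codimOne_of_all (drExact_of_pderiv_eq_zero 0 ?_)
    simp [conicQ]

/-- **DECIDED (m = 2, PROVED, N = 0) — EVERY DENOMINATOR OF DEGREE ≤ 2:** for `Q = ζ + δx + εy + αx² + βxy + γy²` zero-free on the square and the
functional `Λ_Q` of `codimOne_degTwo`, every `[ [0,1]², P/Q ]` with `Λ_Q P = 0` and value `0` lies in `relations`. [cite: KontsevichZagier2001, §1.2] -/
theorem degTwo_two_mem_relations (α β γ δ ε ζ : ℚ) :
    ∃ Λ : MvPolynomial (Fin 2) ℚ →ₗ[ℚ] ℚ, ∀ (q : IntegralRep 2) (P : MvPolynomial (Fin 2) ℚ), Λ P = 0 →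
      q.domain = Set.pi Set.univ (fun _ : Fin 2 => Set.Icc (0:ℝ) 1) →
      (∀ z ∈ Set.pi Set.univ (fun _ : Fin 2 => Set.Icc (0:ℝ) 1), MvPolynomial.aeval z (conicQ α β γ δ ε ζ) ≠ 0) →
      (∀ z ∈ Set.pi Set.univ (fun _ : Fin 2 => Set.Icc (0:ℝ) 1),
        q.integrand z = MvPolynomial.aeval z P / MvPolynomial.aeval z (conicQ α β γ δ ε ζ)) →
      q.value = 0 → of q ∈ relations := by
  obtain ⟨Λ, hΛ⟩ := codimOne_degTwo α β γ δ ε ζ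
  refine ⟨Λ, fun q P hP hd hQ hf h0 => ?_⟩
  have h := hΛ P
  rw [hP, map_zero, sub_zero] at h
  obtain ⟨s, G, hid⟩ := h
  exact mem_relations_of_exact_two q _ _ s G hid hd hQ hf h0

/-- **26322 on EVERY degree-≤-2 denominator ⟸ a ONE-parameter residual (PROVED split):** with `Λ_Q` as above, only the numerators with `Λ_Q P ≠ 0`
(congruent to a NON-zero multiple of `1/Q`) remain. [folklore] -/
theorem degTwo_single_of_residual (α β γ δ ε ζ : ℚ) :
    ∃ Λ : MvPolynomial (Fin 2) ℚ →ₗ[ℚ] ℚ,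
      (∀ (q : IntegralRep 2) (P : MvPolynomial (Fin 2) ℚ), Λ P ≠ 0 →
        q.domain = Set.pi Set.univ (fun _ : Fin 2 => Set.Icc (0:ℝ) 1) →
        (∀ z ∈ Set.pi Set.univ (fun _ : Fin 2 => Set.Icc (0:ℝ) 1), MvPolynomial.aeval z (conicQ α β γ δ ε ζ) ≠ 0) →
        (∀ z ∈ Set.pi Set.univ (fun _ : Fin 2 => Set.Icc (0:ℝ) 1),
          q.integrand z = MvPolynomial.aeval z P / MvPolynomial.aeval z (conicQ α β γ δ ε ζ)) →
        q.value = 0 → ∃ N : ℕ, (fun y : FormalRep => of piRep * y)^[N] (of q) ∈ relations) →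
      ∀ (q : IntegralRep 2) (P : MvPolynomial (Fin 2) ℚ),
        q.domain = Set.pi Set.univ (fun _ : Fin 2 => Set.Icc (0:ℝ) 1) →
        (∀ z ∈ Set.pi Set.univ (fun _ : Fin 2 => Set.Icc (0:ℝ) 1), MvPolynomial.aeval z (conicQ α β γ δ ε ζ) ≠ 0) →
        (∀ z ∈ Set.pi Set.univ (fun _ : Fin 2 => Set.Icc (0:ℝ) 1),
          q.integrand z = MvPolynomial.aeval z P / MvPolynomial.aeval z (conicQ α β γ δ ε ζ)) →
        q.value = 0 → ∃ N : ℕ, (fun y : FormalRep => of piRep * y)^[N] (of q) ∈ relations := by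
  obtain ⟨Λ, hΛ⟩ := degTwo_two_mem_relations α β γ δ ε ζ
  refine ⟨Λ, fun hres q P hd hQ hf h0 => ?_⟩
  by_cases hP : Λ P = 0
  · exact ⟨0, by simpa using hΛ q P hP hd hQ hf h0⟩
  · exact hres q P hP hd hQ hf h0

/-! ### §14b From `totalDegree ≤ 2` to the coefficient form -/

/-- Auxiliary step `finsupp_fin_two_eq` (§14b): finsupp fin two eq. [bookkeeping] -/
theorem finsupp_fin_two_eq (d : Fin 2 →₀ ℕ) : d = Finsupp.single 0 (d 0) + Finsupp.single 1 (d 1) := by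
  ext k
  fin_cases k <;> simp

/-- Auxiliary step `single_add_single_inj` (§14b): single add single inj. [bookkeeping] -/
theorem single_add_single_inj (a b i j : ℕ) :
    (Finsupp.single 0 a + Finsupp.single 1 b : Fin 2 →₀ ℕ) = Finsupp.single 0 i + Finsupp.single 1 j ↔ a = i ∧ b = j := by
  constructor
  · intro h
    have h0 := DFunLike.congr_fun h 0
    have h1 := DFunLike.congr_fun h 1
    simp at h0 h1
    exact ⟨h0, h1⟩
  · rintro ⟨rfl, rfl⟩
    rfl

/-- Auxiliary step `conicQ_eq_sum_monomial` (§14b): conic Q eq sum monomial. [bookkeeping] -/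
theorem conicQ_eq_sum_monomial (α β γ δ ε ζ : ℚ) :
    conicQ α β γ δ ε ζ
      = monomial (Finsupp.single 0 0 + Finsupp.single 1 0) ζ + monomial (Finsupp.single 0 1 + Finsupp.single 1 0) δ
        + monomial (Finsupp.single 0 0 + Finsupp.single 1 1) ε + monomial (Finsupp.single 0 2 + Finsupp.single 1 0) α
        + monomial (Finsupp.single 0 1 + Finsupp.single 1 1) β + monomial (Finsupp.single 0 0 + Finsupp.single 1 2) γ := by
  simp only [conicQ, X_pow_eq_monomial, C_mul_monomial, mul_one]
  rw [show (X 0 : MvPolynomial (Fin 2) ℚ) = monomial (Finsupp.single 0 1) 1 from rfl,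
    show (X 1 : MvPolynomial (Fin 2) ℚ) = monomial (Finsupp.single 1 1) 1 from rfl, monomial_mul, C_mul_monomial,
    C_mul_monomial, C_mul_monomial, C_apply]
  simp only [Finsupp.single_zero, zero_add, add_zero, mul_one]

/-- Auxiliary step `degree_single_add_single` (§14b): degree single add single. [bookkeeping] -/
theorem degree_single_add_single (i j : ℕ) :
    ∑ k ∈ (Finsupp.single 0 i + Finsupp.single 1 j : Fin 2 →₀ ℕ).support, (Finsupp.single 0 i + Finsupp.single 1 j : Fin 2 →₀ ℕ) k
      = i + j := by
  rw [← Finsupp.degree_apply, map_add, Finsupp.degree_single, Finsupp.degree_single]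

/-- Every `Q` of total degree ≤ 2 is a `conicQ` of its six coefficients. [folklore] -/
theorem eq_conicQ_of_totalDegree_le_two (Q : MvPolynomial (Fin 2) ℚ) (h : Q.totalDegree ≤ 2) :
    Q = conicQ (coeff (Finsupp.single 0 2 + Finsupp.single 1 0) Q) (coeff (Finsupp.single 0 1 + Finsupp.single 1 1) Q)
      (coeff (Finsupp.single 0 0 + Finsupp.single 1 2) Q) (coeff (Finsupp.single 0 1 + Finsupp.single 1 0) Q)
      (coeff (Finsupp.single 0 0 + Finsupp.single 1 1) Q) (coeff (Finsupp.single 0 0 + Finsupp.single 1 0) Q) := by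
  ext d
  rw [finsupp_fin_two_eq d]
  generalize d 0 = i
  generalize d 1 = j
  rw [conicQ_eq_sum_monomial]
  simp only [coeff_add, coeff_monomial, single_add_single_inj]
  rcases Nat.lt_or_ge 2 (i + j) with hij | hij
  · have hz : coeff (Finsupp.single 0 i + Finsupp.single 1 j) Q = 0 :=
      coeff_eq_zero_of_totalDegree_lt (by rw [degree_single_add_single]; omega)
    rw [hz]
    split_ifs <;> first | omega | simp
  · have hi : i ≤ 2 := by omega
    have hj : j ≤ 2 := by omega
    interval_cases i <;> interval_cases j <;> first | omega | simp

/-- **THE CODIMENSION-ONE THEOREM, `totalDegree` form**: every `Q ∈ ℚ[x,y]` with `totalDegree Q ≤ 2` has `CodimOne Q`. [folklore] -/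
theorem codimOne_of_totalDegree_le_two (Q : MvPolynomial (Fin 2) ℚ) (h : Q.totalDegree ≤ 2) : CodimOne Q := by
  rw [eq_conicQ_of_totalDegree_le_two Q h]
  exact codimOne_degTwo _ _ _ _ _ _

/-- **DECIDED + ONE PARAMETER on every denominator of total degree ≤ 2 (m = 2, N = 0)** — the census box in one statement: there is a `ℚ`-linear
`Λ` with (a) `Λ P = 0`, zero-free, value `0` ⟹ `[ [0,1]², P/Q ] ∈ relations`, and (b) 26322 on `Q` ⟸ the residual `Λ P ≠ 0`. [cite: KontsevichZagier2001, §1.2] -/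
theorem totalDegree_le_two_decided (Q : MvPolynomial (Fin 2) ℚ) (h : Q.totalDegree ≤ 2) :
    ∃ Λ : MvPolynomial (Fin 2) ℚ →ₗ[ℚ] ℚ,
      (∀ (q : IntegralRep 2) (P : MvPolynomial (Fin 2) ℚ), Λ P = 0 →
        q.domain = Set.pi Set.univ (fun _ : Fin 2 => Set.Icc (0:ℝ) 1) →
        (∀ z ∈ Set.pi Set.univ (fun _ : Fin 2 => Set.Icc (0:ℝ) 1), MvPolynomial.aeval z Q ≠ 0) →
        (∀ z ∈ Set.pi Set.univ (fun _ : Fin 2 => Set.Icc (0:ℝ) 1),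
          q.integrand z = MvPolynomial.aeval z P / MvPolynomial.aeval z Q) →
        q.value = 0 → of q ∈ relations) ∧
      ((∀ (q : IntegralRep 2) (P : MvPolynomial (Fin 2) ℚ), Λ P ≠ 0 →
        q.domain = Set.pi Set.univ (fun _ : Fin 2 => Set.Icc (0:ℝ) 1) →
        (∀ z ∈ Set.pi Set.univ (fun _ : Fin 2 => Set.Icc (0:ℝ) 1), MvPolynomial.aeval z Q ≠ 0) →
        (∀ z ∈ Set.pi Set.univ (fun _ : Fin 2 => Set.Icc (0:ℝ) 1),
          q.integrand z = MvPolynomial.aeval z P / MvPolynomial.aeval z Q) →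
        q.value = 0 → ∃ N : ℕ, (fun y : FormalRep => of piRep * y)^[N] (of q) ∈ relations) →
      ∀ (q : IntegralRep 2) (P : MvPolynomial (Fin 2) ℚ),
        q.domain = Set.pi Set.univ (fun _ : Fin 2 => Set.Icc (0:ℝ) 1) →
        (∀ z ∈ Set.pi Set.univ (fun _ : Fin 2 => Set.Icc (0:ℝ) 1), MvPolynomial.aeval z Q ≠ 0) →
        (∀ z ∈ Set.pi Set.univ (fun _ : Fin 2 => Set.Icc (0:ℝ) 1),
          q.integrand z = MvPolynomial.aeval z P / MvPolynomial.aeval z Q) →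
        q.value = 0 → ∃ N : ℕ, (fun y : FormalRep => of piRep * y)^[N] (of q) ∈ relations) := by
  obtain ⟨Λ, hΛ⟩ := codimOne_of_totalDegree_le_two Q h
  have hdec : ∀ (q : IntegralRep 2) (P : MvPolynomial (Fin 2) ℚ), Λ P = 0 →
      q.domain = Set.pi Set.univ (fun _ : Fin 2 => Set.Icc (0:ℝ) 1) →
      (∀ z ∈ Set.pi Set.univ (fun _ : Fin 2 => Set.Icc (0:ℝ) 1), MvPolynomial.aeval z Q ≠ 0) →
      (∀ z ∈ Set.pi Set.univ (fun _ : Fin 2 => Set.Icc (0:ℝ) 1),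
        q.integrand z = MvPolynomial.aeval z P / MvPolynomial.aeval z Q) →
      q.value = 0 → of q ∈ relations := by
    intro q P hP hd hQ hf h0
    have h1 := hΛ P
    rw [hP, map_zero, sub_zero] at h1
    obtain ⟨s, G, hid⟩ := h1
    exact mem_relations_of_exact_two q _ _ s G hid hd hQ hf h0
  refine ⟨Λ, hdec, fun hres q P hd hQ hf h0 => ?_⟩
  by_cases hP : Λ P = 0
  · exact ⟨0, by simpa using hdec q P hP hd hQ hf h0⟩
  · exact hres q P hP hd hQ hf h0

/-! ## §15 (v11) BRIESKORN–PHAM DENOMINATORS `c + α x^{p+1} + β y^{q+1}` — the first classes of EVERY degree, codimension ≤ `p·q`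

The Hamiltonian field `H = (q+1)β y^q ∂_x − (p+1)α x^p ∂_y` of `Q_w = α x^{p+1} + β y^{q+1}` kills `Q = c + Q_w` and is divergence-free, so
`H h ∈ Ex0 Q` for every `h` (`ham_mem`: the Poisson-bracket relations, generalising §13's `lie_mem`); with `Q·h ∈ Ex0` this gives the two
DESCENTS `x^{i+p+1} y^j ≡ ρx·x^i y^j`, `x^i y^{j+q+1} ≡ ρy·x^i y^j` (explicit rational factors, denominators `S(i,j) = (i+1)(q+1) + (j+1)(p+1)`)
and the vanishing of the two box edges `x^p y^j ≡ 0 ≡ x^i y^q`. Hence EVERY monomial is congruent to a rational multiple of ONE box monomial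
`x^{i₀} y^{j₀}`, `i₀ < p`, `j₀ < q` (`bpMon_sub_red_mem`), and the reduced numerator `bpRed P` (linear, supported in the `p × q` box) satisfies
`P − bpRed P ∈ Ex0 Q` (`sub_bpRed_mem`): **codimension of the exact numerators ≤ p·q = the Milnor number of `Q_w`** (= rank `H¹` of the Milnor fibre
`{Q_w = −c}`): lines/graphs `p·q = 0` (all exact), conics `1`, the elliptic denominators `c + αx³ + βy²` → `2` (the two elliptic periods), Fermat cubics
`c + αx³ + βy³` → `4`, … . For the route: `bp_two_mem_relations` (26322 DECIDED, N = 0, on `bpRed P = 0`) and the PROVED split `bp_single_of_residual`. -/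

/-- Brieskorn–Pham denominator `c + α x^{p+1} + β y^{q+1}`. [folklore] -/
def bpQ (c α β : ℚ) (p q : ℕ) : MvPolynomial (Fin 2) ℚ := C c + C α * X 0 ^ (p + 1) + C β * X 1 ^ (q + 1)

/-- The Hamiltonian field of `Q_w` gives `H h ∈ Ex0` for every `h` (potentials `((q+1)β y^q h, −(p+1)α x^p h)`). [folklore] -/
theorem ham_mem (c α β : ℚ) (p q : ℕ) (h : MvPolynomial (Fin 2) ℚ) :
    C (((q : ℚ) + 1) * β) * X 1 ^ q * pderiv 0 h - C (((p : ℚ) + 1) * α) * X 0 ^ p * pderiv 1 h ∈ Ex0 (bpQ c α β p q) := by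
  refine mem_ex0_iff.mpr ⟨![C (((q : ℚ) + 1) * β) * X 1 ^ q * h, -(C (((p : ℚ) + 1) * α) * X 0 ^ p * h)], ?_⟩
  simp only [Fin.sum_univ_two, Matrix.cons_val_zero, Matrix.cons_val_one, exS, bpQ, map_add, map_neg,
    pderiv_C, Derivation.leibniz, Derivation.leibniz_pow, smul_eq_mul, pderiv_X_self,
    pderiv_one_X_zero, pderiv_zero_X_one, nsmul_eq_mul, Nat.cast_zero, zero_add, mul_one,
    mul_zero, add_zero, smul_zero, Nat.cast_add, Nat.cast_one, Nat.add_one_sub_one, neg_mul]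
  simp only [map_mul, map_add, map_one, map_natCast]
  ring

/-- HOP: `(i+1)(q+1)β·x^i y^{j+q+1} − (j+1)(p+1)α·x^{i+p+1} y^j ∈ Ex0` (`= H(x^{i+1} y^{j+1})`). [folklore] -/
theorem hopBP_mem (c α β : ℚ) (p q i j : ℕ) :
    (C (((i : ℚ) + 1) * (((q : ℚ) + 1) * β)) * (X 0 ^ i * X 1 ^ (j + q + 1))
      - C (((j : ℚ) + 1) * (((p : ℚ) + 1) * α)) * (X 0 ^ (i + p + 1) * X 1 ^ j) : MvPolynomial (Fin 2) ℚ)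
      ∈ Ex0 (bpQ c α β p q) := by
  have key : (C (((i : ℚ) + 1) * (((q : ℚ) + 1) * β)) * (X 0 ^ i * X 1 ^ (j + q + 1))
      - C (((j : ℚ) + 1) * (((p : ℚ) + 1) * α)) * (X 0 ^ (i + p + 1) * X 1 ^ j) : MvPolynomial (Fin 2) ℚ)
      = C (((q : ℚ) + 1) * β) * X 1 ^ q * pderiv 0 (X 0 ^ (i + 1) * X 1 ^ (j + 1))
        - C (((p : ℚ) + 1) * α) * X 0 ^ p * pderiv 1 (X 0 ^ (i + 1) * X 1 ^ (j + 1)) := by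
    simp only [Derivation.leibniz, Derivation.leibniz_pow, smul_eq_mul, pderiv_X_self, pderiv_one_X_zero,
      pderiv_zero_X_one, nsmul_eq_mul, mul_one, mul_zero, add_zero, zero_add, Nat.cast_add, Nat.cast_one,
      Nat.add_one_sub_one, map_mul, map_add, map_one, map_natCast]
    ring
  rw [key]
  exact ham_mem c α β p q _

/-- Box edge: `(j+1)(p+1)α·x^p y^j ∈ Ex0` (`= −H(y^{j+1})`). [folklore] -/
theorem hopBPX_mem (c α β : ℚ) (p q j : ℕ) :
    (C (((j : ℚ) + 1) * (((p : ℚ) + 1) * α)) * (X 0 ^ p * X 1 ^ j) : MvPolynomial (Fin 2) ℚ) ∈ Ex0 (bpQ c α β p q) := by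
  have key : (C (((j : ℚ) + 1) * (((p : ℚ) + 1) * α)) * (X 0 ^ p * X 1 ^ j) : MvPolynomial (Fin 2) ℚ)
      = -(C (((q : ℚ) + 1) * β) * X 1 ^ q * pderiv 0 (X 1 ^ (j + 1))
          - C (((p : ℚ) + 1) * α) * X 0 ^ p * pderiv 1 (X 1 ^ (j + 1))) := by
    simp only [Derivation.leibniz_pow, smul_eq_mul, pderiv_X_self, pderiv_zero_X_one,
      nsmul_eq_mul, mul_one, mul_zero, Nat.cast_add, Nat.cast_one, Nat.add_one_sub_one, map_mul, map_add, map_one,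
      map_natCast, zero_sub, neg_neg]
    ring
  rw [key]
  exact neg_mem (ham_mem c α β p q _)

/-- Box edge: `(i+1)(q+1)β·x^i y^q ∈ Ex0` (`= H(x^{i+1})`). [folklore] -/
theorem hopBPY_mem (c α β : ℚ) (p q i : ℕ) :
    (C (((i : ℚ) + 1) * (((q : ℚ) + 1) * β)) * (X 0 ^ i * X 1 ^ q) : MvPolynomial (Fin 2) ℚ) ∈ Ex0 (bpQ c α β p q) := by
  have key : (C (((i : ℚ) + 1) * (((q : ℚ) + 1) * β)) * (X 0 ^ i * X 1 ^ q) : MvPolynomial (Fin 2) ℚ)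
      = C (((q : ℚ) + 1) * β) * X 1 ^ q * pderiv 0 (X 0 ^ (i + 1))
          - C (((p : ℚ) + 1) * α) * X 0 ^ p * pderiv 1 (X 0 ^ (i + 1)) := by
    simp only [Derivation.leibniz_pow, smul_eq_mul, pderiv_X_self, pderiv_one_X_zero,
      nsmul_eq_mul, mul_one, mul_zero, Nat.cast_add, Nat.cast_one, Nat.add_one_sub_one, map_mul, map_add, map_one,
      map_natCast, sub_zero]
    ring
  rw [key]
  exact ham_mem c α β p q _

/-- The descent denominator `S(i,j) = (i+1)(q+1) + (j+1)(p+1) > 0`. [folklore] -/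
def bpS (p q i j : ℕ) : ℚ := ((i : ℚ) + 1) * ((q : ℚ) + 1) + ((j : ℚ) + 1) * ((p : ℚ) + 1)

/-- Auxiliary step `bpS_pos` (§15): bp S pos. [bookkeeping] -/
theorem bpS_pos (p q i j : ℕ) : 0 < bpS p q i j := by unfold bpS; positivity

/-- Auxiliary step `bpS_ne` (§15): bp S ne. [bookkeeping] -/
theorem bpS_ne (p q i j : ℕ) : bpS p q i j ≠ 0 := (bpS_pos p q i j).ne'

/-- x-DESCENT relation: `α·S·x^{i+p+1} y^j + (i+1)(q+1)c·x^i y^j ∈ Ex0` (`= (i+1)(q+1)·Q·x^i y^j − HOP`). [folklore] -/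
theorem descX_mem (c α β : ℚ) (p q i j : ℕ) :
    (C (α * bpS p q i j) * (X 0 ^ (i + p + 1) * X 1 ^ j) + C (((i : ℚ) + 1) * ((q : ℚ) + 1) * c) * (X 0 ^ i * X 1 ^ j)
      : MvPolynomial (Fin 2) ℚ) ∈ Ex0 (bpQ c α β p q) := by
  have key : (C (α * bpS p q i j) * (X 0 ^ (i + p + 1) * X 1 ^ j) + C (((i : ℚ) + 1) * ((q : ℚ) + 1) * c) * (X 0 ^ i * X 1 ^ j)
      : MvPolynomial (Fin 2) ℚ)
      = (((i : ℚ) + 1) * ((q : ℚ) + 1)) • (bpQ c α β p q * (X 0 ^ i * X 1 ^ j))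
        - (C (((i : ℚ) + 1) * (((q : ℚ) + 1) * β)) * (X 0 ^ i * X 1 ^ (j + q + 1))
            - C (((j : ℚ) + 1) * (((p : ℚ) + 1) * α)) * (X 0 ^ (i + p + 1) * X 1 ^ j)) := by
    rw [smul_eq_C_mul, bpQ, bpS]
    simp only [map_mul, map_add, map_one, map_natCast]
    ring
  rw [key]
  exact sub_mem (Submodule.smul_mem _ _ (mul_mem_ex0 _ _)) (hopBP_mem c α β p q i j)

/-- y-DESCENT relation: `β·S·x^i y^{j+q+1} + (j+1)(p+1)c·x^i y^j ∈ Ex0` (`= (j+1)(p+1)·Q·x^i y^j + HOP`). [folklore] -/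
theorem descY_mem (c α β : ℚ) (p q i j : ℕ) :
    (C (β * bpS p q i j) * (X 0 ^ i * X 1 ^ (j + q + 1)) + C (((j : ℚ) + 1) * ((p : ℚ) + 1) * c) * (X 0 ^ i * X 1 ^ j)
      : MvPolynomial (Fin 2) ℚ) ∈ Ex0 (bpQ c α β p q) := by
  have key : (C (β * bpS p q i j) * (X 0 ^ i * X 1 ^ (j + q + 1)) + C (((j : ℚ) + 1) * ((p : ℚ) + 1) * c) * (X 0 ^ i * X 1 ^ j)
      : MvPolynomial (Fin 2) ℚ)
      = (((j : ℚ) + 1) * ((p : ℚ) + 1)) • (bpQ c α β p q * (X 0 ^ i * X 1 ^ j))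
        + (C (((i : ℚ) + 1) * (((q : ℚ) + 1) * β)) * (X 0 ^ i * X 1 ^ (j + q + 1))
            - C (((j : ℚ) + 1) * (((p : ℚ) + 1) * α)) * (X 0 ^ (i + p + 1) * X 1 ^ j)) := by
    rw [smul_eq_C_mul, bpQ, bpS]
    simp only [map_mul, map_add, map_one, map_natCast]
    ring
  rw [key]
  exact add_mem (Submodule.smul_mem _ _ (mul_mem_ex0 _ _)) (hopBP_mem c α β p q i j)

/-- Box edges vanish: `x^p y^j ∈ Ex0` (`α ≠ 0`) and `x^i y^q ∈ Ex0` (`β ≠ 0`). [folklore] -/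
theorem boxX_mem (c α β : ℚ) (hα : α ≠ 0) (p q j : ℕ) :
    (X 0 ^ p * X 1 ^ j : MvPolynomial (Fin 2) ℚ) ∈ Ex0 (bpQ c α β p q) := by
  have hc : ((j : ℚ) + 1) * (((p : ℚ) + 1) * α) ≠ 0 := mul_ne_zero (by positivity) (mul_ne_zero (by positivity) hα)
  refine (Submodule.smul_mem_iff _ hc).mp ?_
  rw [smul_eq_C_mul]
  exact hopBPX_mem c α β p q j

end Summit.KontsevichZagierPeriods.RootDecompRationalCubeDichotomy.Rung26322.RankDescent
end
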